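/-
Copyright: cell `pub-balaban-gaps` (G2), seat ne6 (row NE7b), `prover-pub-balaban-gaps-ne6-g15-0`. Released under the licence of the
surrounding project.
-/
import Summits.QuantumFields.BalabanUV.T4Continuum.Spine.NE7b.CompactFibreWindowSUN
import Literature.MathematicalPhysics.QuantumFieldTheory.Balaban1983to89.HaarSmallBallTwoSided
import Literature.MathematicalPhysics.QuantumFieldTheory.Balaban1983to89.MatrixNorms

/-!
# THE WINDOW-VOLUME LETTER FOR `SU(N)` AT PRINT's RATE `½·d(𝔤)`, `d(𝔤) = dim SU(N) = N² − 1`, FOR ALL `N` — BY NAME from the tree's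
# two-sided small-ball law for compact linear groups ([VaropoulosSaloffcosteCoulhon1993] Thm. V.4.1 as `HaarSmallBallTwoSided`):
# `C⁻¹η^{N²−1} ≤ Haar_{SU(N)}{‖V − 1‖_HS ≤ η} ≤ Cη^{N²−1}`, hence `|−log κ(Π_b W) − #bonds·(N² − 1)·log η⁻¹| ≤ #bonds·c` and
# `−log Haar{Re tr(1 − V) ≤ t} ∕ log t⁻¹ → (N² − 1)∕2` (row NE7b, node U5c; sharpens `CompactFibreWindowSUN`, exponent `N² = dim U(N)`)

Cell `pub-balaban-gaps` (G2 spine census) for the `pub-balaban` T⁴ crux NE7b (`T4WeightBudget.RelWeightBound`; the cell's OWN estimate — NOT PRINTED in [Bałaban 1983–89], NOT PROVED).  Crux-route work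
under `Spine/NE7b/`; NOTHING of Bałaban's is named or asserted; no `T4Continuum/Support` leaf typed; no `def`; zero `sorry`.  Imports: this seat's `CompactFibreWindowSUN` (the OWNER's
`CompactFibreCarrier`, the junction `CompactFibreWindowSU2.compactFibre_moment_le_window_exp`, the trace dictionary `sball_eq_traceWindow`, `pi_sball_toReal_eq`), the tree's
`Balaban1983to89.HaarSmallBallTwoSided` (cell `lit-balaban`: `haar_ball_two_sided_of_unitaryRep`, both halves of [VaropoulosSaloffcosteCoulhon1993] Thm. V.4.1 for every compact group presented in `U(N)`,
operator-norm balls, exponent `dim_ℝ 𝔤`) and `Balaban1983to89.MatrixNorms` ([Balaban1985Averaging] (20): `‖X‖ ≤ |X| ≤ √N‖X‖` between the operator and Hilbert–Schmidt norms).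

WHY.  `CompactFibreWindowSUN` (this seat, gen 11) values the OWNER g106's RULING-4 letter `κ(G)` for the headline's group `SU(N)`, every `N`, from Chatterjee's `U(N)` Hilbert–Schmidt ball by AVERAGED
SECTIONS — with the exponent `N² = dim U(N)`; its honest remark: «the exponent `N²` is `dim U(N)`, not `dim SU(N) = N² − 1` (any power law gives O(log η⁻¹) per bond)».  `CompactFibreWindowSU2Rate` (gen 14)
reached print's rate `½d(𝔤) = 3∕2` for `N = 2` through the quaternion chart.  The rate `d(𝔤)` in `log g` is the shape in which the cell READS print's
window normalisations for a general compact `G` (the reader's item `ZLower` of the tree's `B16B10Shape`, «log z ≥ d(𝐠)·log g_j − C_z», for [B12] (0.15)'s `z`; [B16] p. 383 «the constant with the logarithms»).  The TREE meanwhile PROVES the sharp exponent for every closed `G ≤ U(N)`: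
`HaarSmallBallClosedSubgroup.haar_ball_ge_of_unitaryRep` (lower half, exponential chart of a closed linear group + nets) and `HaarSmallBallTwoSided.haar_ball_le_of_unitaryRep` (upper half, disjoint
translates at exponentials of a separated set), assembled as `haar_ball_two_sided_of_unitaryRep`, with `dim_ℝ 𝔰𝔲(N) = N² − 1` (`QuantumLattice.finrank_matrixLieAlgebra_specialUnitaryGroup`).  THIS FILE is
the junction: the tree's operator-norm law at the fundamental representation of `SU(N)` ⟹ the same law for the Hilbert–Schmidt window of `CompactFibreWindowSUN` (constants absorb `√N^{N²−1}`) ⟹ the row's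
letters at print's rate for ALL `N`, in the OWNER's currency.

WHAT IS PROVED ([folklore]; every constant SOFT — existential, from the tree's compactness constants):
* §1 (operator norm) `exists_haarReal_opBall_two_sided` (the tree's law read at `SU(N)`: `C⁻¹r^{N²−1} ≤ Haar{‖V − 1‖_op ≤ r} ≤ Cr^{N²−1}`, `0 < r ≤ R`); the two inclusions `sum_norm_sq_le_of_opNorm_le` ∕
  `opNorm_le_of_sum_norm_sq_le`; `exists_haarReal_hsBall_two_sided` (`N ≥ 1`).
* §2 (Hilbert–Schmidt window `SB η = {‖V − 1‖_HS ≤ η}` of `CompactFibreWindowSUN`, ALL `N`): **`exists_haarReal_sball_two_sided`** (`C ≥ 1`, `C⁻¹η^{N²−1} ≤ Haar(SB η) ≤ Cη^{N²−1}` on `0 < η ≤ R`),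
  `exists_haar_sball_ge_sharp` ∕ `exists_haar_sball_le_sharp` (`ℝ≥0∞` forms on `0 < η ≤ 2`), **`exists_abs_neg_log_haar_sball_sub_le`** (`|−log Haar(SB η) − (N² − 1)·log η⁻¹| ≤ c`),
  `exists_neg_log_haar_sball_le_sharp` (the price), **`tendsto_neg_log_haar_sball_div_log`** (`−log Haar(SB η)∕log η⁻¹ → N² − 1`); the TRACE window `{Re tr(1 − V) ≤ t} = SB √(2t)`:
  `exists_haarReal_traceWindow_two_sided`, **`exists_abs_neg_log_haar_traceWindow_sub_le`** (`|−log Haar − ((N² − 1)∕2)·log t⁻¹| ≤ c`), **`tendsto_neg_log_haar_traceWindow_div_log`** (`→ (N² − 1)∕2 = ½·dim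
  SU(N)`, print's rate; `N = 2`: `3∕2`); `exists_neg_log_haar_sball_le_print_shape` (at `η = C₀g`: `≤ (N² − 1)·log g⁻¹ + O(1)`, the `ZLower` shape).
* §3 (a region `bonds → SU(N)`, product Haar): **`exists_abs_neg_log_pi_sball_sub_le`** (`|−log κ(Π_b SB η) − #B·(N² − 1)·log η⁻¹| ≤ #B·c`), `exists_neg_log_pi_sball_le_sharp` (the per-bond PRICE `≤
  #B·((N² − 1)·log η⁻¹ + c)` — `CompactFibreWindowSUN.exists_neg_log_pi_sball_le`'s `#B·(N²·log(2∕η) − log C)` at print's rate), **`exists_compactFibre_moment_le_SUNwindow_sharp`** (the junction with the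
  OWNER's display, price `exp(i⁺ + #B·((N² − 1)·log η⁻¹ + c))`), `exists_abs_neg_log_pi_traceWindow_sub_le` (trace-window region pin at `½d(𝔤)`).

HONEST REMARKS.  (a) The constants are NOT explicit (the tree's: a finite subcover and a norm bound of `exp′` by compactness, a strict-differentiability radius of `exp`); only the EXPONENT is sharp.
Explicit-constant companions in the tree: `B16ZLower.haarReal_suOpBall_ge` (`SU(N)`, op-norm, lower half, `(4π∕((2N+1)r))·(r∕(16π+r))^{N²}`) and, for `N = 2`, `CompactFibreWindowSU2Rate` (`η√η∕160 ≤ Haar ≤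
12η√η`).  (b) The exponent is written `N ^ 2 - 1 : ℕ` (`= dim SU(N)` for `N ≥ 1`, `cast_dim`; for `N = 0` both the group and the exponent are trivial).  (c) Which window ∕ `η(g_j)` print uses at a creation
step and that Bałaban's creation-level carrier IS the compact-fibre one are (A3) ∕ (A1c) readings — NOT asserted.  Nothing of Bałaban's is asserted, valued or discharged.  NE7b NOT PRINTED ∕ NOT PROVED;
spine PROVED 0∕9; rung (B)+1 on a FINITE torus — NOT infinite volume, NOT the mass gap, NOT Clay.
HONEST DEPENDENCY: continuum YM on T⁴ ⇐ BetaPertH ∧ nine spine estimates (0/9 proved); BetaPertH ⇐ (D1) ∧ (D4) ∧ CAP+tail;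
G-an2-4 gates asym, D1 and NE2/3/4.  This file changes none of it.
-/

set_option autoImplicit false

open MeasureTheory Real Finset Filter Topology
open scoped ENNReal
open Literature.MathematicalPhysics.QuantumFieldTheory (haarProbability)
open Literature.MathematicalPhysics.QuantumLattice (fundamentalRep fundamentalRep_apply continuous_fundamentalRep fundamentalRep_mem_unitaryGroup matrixLieAlgebra
  finrank_matrixLieAlgebra_specialUnitaryGroup)
open Literature.MathematicalPhysics.QuantumFieldTheory.Balaban1983to89.HaarSmallBallClosedSubgroup (haar_ball_two_sided_of_unitaryRep)
open Literature.MathematicalPhysics.QuantumFieldTheory.Balaban1983to89.MatrixNorms (opNorm_sq_le_sum_norm_sq nhsNormSq_le_opNorm_sq nhsNormSq)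

namespace Summit.QuantumFields.BalabanUV.T4Continuum.NE7b.CompactFibreWindowSUNRate

noncomputable section

variable {N : ℕ}

/-! ## §1 The tree's two-sided law in the OPERATOR norm, specialised to `SU(N)`; transfer to the entrywise (Hilbert–Schmidt) ball -/

section OpNorm

open scoped Matrix.Norms.L2Operator

/-- **THE TREE's LAW, `G = SU(N)`, OPERATOR-NORM BALLS**: for every `R > 0` there is `C > 0` with
`C⁻¹·r^{N²−1} ≤ Haar_{SU(N)}{‖V − 1‖_op ≤ r} ≤ C·r^{N²−1}` for all `0 < r ≤ R` — the tree's `haar_ball_two_sided_of_unitaryRep`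
([VaropoulosSaloffcosteCoulhon1993] Thm. V.4.1 for compact linear groups) at the fundamental representation, with
`dim_ℝ 𝔰𝔲(N) = N² − 1` (`finrank_matrixLieAlgebra_specialUnitaryGroup`). [folklore] -/
theorem exists_haarReal_opBall_two_sided {R : ℝ} (hR : 0 < R) : ∃ C : ℝ, 0 < C ∧ ∀ r : ℝ, 0 < r → r ≤ R → C⁻¹ * r ^ (N ^ 2 - 1) ≤ (haarProbability (Matrix.specialUnitaryGroup (Fin N) ℂ)).real {V : Matrix.specialUnitaryGroup (Fin N) ℂ | ‖(V : Matrix (Fin N) (Fin N) ℂ) - 1‖ ≤ r} ∧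
    (haarProbability (Matrix.specialUnitaryGroup (Fin N) ℂ)).real {V : Matrix.specialUnitaryGroup (Fin N) ℂ | ‖(V : Matrix (Fin N) (Fin N) ℂ) - 1‖ ≤ r} ≤ C * r ^ (N ^ 2 - 1) := by
  have hrange : Set.range (fundamentalRep (Fin N)) = (Matrix.specialUnitaryGroup (Fin N) ℂ : Set (Matrix (Fin N) (Fin N) ℂ)) :=
    Set.ext fun A => ⟨fun ⟨V, hV⟩ => hV ▸ V.2, fun hA => ⟨⟨A, hA⟩, rfl⟩⟩
  have hd : Module.finrank ℝ (matrixLieAlgebra (Set.range (fundamentalRep (Fin N)))) = N ^ 2 - 1 := by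
    rw [hrange, finrank_matrixLieAlgebra_specialUnitaryGroup, Fintype.card_fin]
  obtain ⟨C, hC, h⟩ := haar_ball_two_sided_of_unitaryRep (G := Matrix.specialUnitaryGroup (Fin N) ℂ) (fundamentalRep (Fin N))
    (continuous_fundamentalRep (Fin N)) fundamentalRep_mem_unitaryGroup hR
  exact ⟨C, hC, fun r hr hrR => by simpa only [hd, fundamentalRep_apply] using h (haarProbability (Matrix.specialUnitaryGroup (Fin N) ℂ)) r hr hrR⟩

/-- Operator-norm balls lie in entrywise balls: `‖A‖_op ≤ r ⇒ Σ_{ij}|A_{ij}|² ≤ N·r²` ([Balaban1985Averaging] (20) `‖X‖ ≤ |X|` for the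
normalised Hilbert–Schmidt norm; tree `MatrixNorms.nhsNormSq_le_opNorm_sq`). [folklore] -/
theorem sum_norm_sq_le_of_opNorm_le {A : Matrix (Fin N) (Fin N) ℂ} {r : ℝ} (h : ‖A‖ ≤ r) : ∑ i, ∑ j, ‖A i j‖ ^ 2 ≤ N * r ^ 2 := by
  rcases Nat.eq_zero_or_pos N with hN | hN
  · subst hN; simp
  · have h1 := nhsNormSq_le_opNorm_sq A
    have h2 : ‖A‖ ^ 2 ≤ r ^ 2 := pow_le_pow_left₀ (norm_nonneg _) h 2
    have hN' : (0 : ℝ) < N := by exact_mod_cast hN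
    unfold nhsNormSq at h1
    rw [Fintype.card_fin, div_le_iff₀ hN'] at h1
    nlinarith

/-- Entrywise balls lie in operator-norm balls: `Σ_{ij}|A_{ij}|² ≤ r² ⇒ ‖A‖_op ≤ r` (`r ≥ 0`; [Balaban1985Averaging] (20) `|X| ≤ √N‖X‖`;
tree `MatrixNorms.opNorm_sq_le_sum_norm_sq`). [folklore] -/
theorem opNorm_le_of_sum_norm_sq_le {A : Matrix (Fin N) (Fin N) ℂ} {r : ℝ} (hr : 0 ≤ r) (h : ∑ i, ∑ j, ‖A i j‖ ^ 2 ≤ r ^ 2) : ‖A‖ ≤ r := by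
  have h1 := opNorm_sq_le_sum_norm_sq A
  exact (pow_le_pow_iff_left₀ (norm_nonneg _) hr two_ne_zero).1 (h1.trans h)

/-- **TWO-SIDED LAW FOR THE ENTRYWISE (HILBERT–SCHMIDT) BALL, `N ≥ 1`**: for every `R > 0` there is `C > 0` with
`C⁻¹·η^{N²−1} ≤ Haar_{SU(N)}{Σ_{ij}|(V − 1)_{ij}|² ≤ η²} ≤ C·η^{N²−1}` for `0 < η ≤ R` (the op-ball of radius `η∕√N` is inside, the op-ball of
radius `η` outside; the constant absorbs `√N^{N²−1}`). [folklore] -/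
theorem exists_haarReal_hsBall_two_sided (hN : 0 < N) {R : ℝ} (hR : 0 < R) : ∃ C : ℝ, 0 < C ∧ ∀ η : ℝ, 0 < η → η ≤ R → C⁻¹ * η ^ (N ^ 2 - 1) ≤ (haarProbability (Matrix.specialUnitaryGroup (Fin N) ℂ)).real {V : Matrix.specialUnitaryGroup (Fin N) ℂ | ∑ i, ∑ j, ‖((V : Matrix (Fin N) (Fin N) ℂ) - 1) i j‖ ^ 2 ≤ η ^ 2} ∧
    (haarProbability (Matrix.specialUnitaryGroup (Fin N) ℂ)).real {V : Matrix.specialUnitaryGroup (Fin N) ℂ | ∑ i, ∑ j, ‖((V : Matrix (Fin N) (Fin N) ℂ) - 1) i j‖ ^ 2 ≤ η ^ 2} ≤ C * η ^ (N ^ 2 - 1) := by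
  obtain ⟨C, hC, h⟩ := exists_haarReal_opBall_two_sided (N := N) hR
  have hsN : 0 < Real.sqrt N := Real.sqrt_pos.2 (by exact_mod_cast hN)
  have hsN1 : 1 ≤ Real.sqrt N := by
    rw [← Real.sqrt_one]; exact Real.sqrt_le_sqrt (by exact_mod_cast hN)
  set d : ℕ := N ^ 2 - 1 with hd
  refine ⟨C * Real.sqrt N ^ d, by positivity, fun η hη hηR => ⟨?_, ?_⟩⟩
  · -- inner op-ball of radius `η / √N`
    have hη' : 0 < η / Real.sqrt N := div_pos hη hsN
    have hη'R : η / Real.sqrt N ≤ R := (div_le_self hη.le hsN1).trans hηR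
    have hsub : {V : Matrix.specialUnitaryGroup (Fin N) ℂ | ‖(V : Matrix (Fin N) (Fin N) ℂ) - 1‖ ≤ η / Real.sqrt N} ⊆ {V : Matrix.specialUnitaryGroup (Fin N) ℂ | ∑ i, ∑ j, ‖((V : Matrix (Fin N) (Fin N) ℂ) - 1) i j‖ ^ 2 ≤ η ^ 2} := by
      intro V hV
      have h1 := sum_norm_sq_le_of_opNorm_le hV
      have h2 : (N : ℝ) * (η / Real.sqrt N) ^ 2 = η ^ 2 := by
        rw [div_pow, Real.sq_sqrt (Nat.cast_nonneg N)]; field_simp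
      simpa [h2] using h1
    have hlow := (h (η / Real.sqrt N) hη' hη'R).1
    calc (C * Real.sqrt N ^ d)⁻¹ * η ^ d = C⁻¹ * (η / Real.sqrt N) ^ d := by
          rw [mul_inv, div_pow, ← inv_pow]; ring
      _ ≤ (haarProbability (Matrix.specialUnitaryGroup (Fin N) ℂ)).real {V : Matrix.specialUnitaryGroup (Fin N) ℂ | ‖(V : Matrix (Fin N) (Fin N) ℂ) - 1‖ ≤ η / Real.sqrt N} := hlow
      _ ≤ _ := measureReal_mono hsub
  · have hsub : {V : Matrix.specialUnitaryGroup (Fin N) ℂ | ∑ i, ∑ j, ‖((V : Matrix (Fin N) (Fin N) ℂ) - 1) i j‖ ^ 2 ≤ η ^ 2} ⊆ {V : Matrix.specialUnitaryGroup (Fin N) ℂ | ‖(V : Matrix (Fin N) (Fin N) ℂ) - 1‖ ≤ η} := fun V hV => opNorm_le_of_sum_norm_sq_le hη.le hV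
    have hup := (h η hη hηR).2
    calc (haarProbability (Matrix.specialUnitaryGroup (Fin N) ℂ)).real {V : Matrix.specialUnitaryGroup (Fin N) ℂ | ∑ i, ∑ j, ‖((V : Matrix (Fin N) (Fin N) ℂ) - 1) i j‖ ^ 2 ≤ η ^ 2}
        ≤ (haarProbability (Matrix.specialUnitaryGroup (Fin N) ℂ)).real {V : Matrix.specialUnitaryGroup (Fin N) ℂ | ‖(V : Matrix (Fin N) (Fin N) ℂ) - 1‖ ≤ η} := measureReal_mono hsub
      _ ≤ C * η ^ d := hup
      _ ≤ C * Real.sqrt N ^ d * η ^ d := by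
          refine mul_le_mul_of_nonneg_right (le_mul_of_one_le_right hC.le (one_le_pow₀ hsN1)) (by positivity)

end OpNorm

/-! ## §2 The Hilbert–Schmidt window of `CompactFibreWindowSUN` (the set `{V : SU(N) | ‖V − 1‖_HS ≤ η}`), ALL `N`: two-sided law, log pins, RATE -/

section HS

open scoped Matrix.Norms.Frobenius

/-- The Hilbert–Schmidt ball is the entrywise ball: `‖A‖_HS ≤ η ⇔ Σ_{ij}|A_{ij}|² ≤ η²` (`η ≥ 0`; tree `UnitaryCayley.frobenius_norm_sq`). [folklore] -/
theorem sball_eq_hsBall {η : ℝ} (hη : 0 ≤ η) : {V : Matrix.specialUnitaryGroup (Fin N) ℂ | ‖(V : Matrix (Fin N) (Fin N) ℂ) - 1‖ ≤ η} = {V : Matrix.specialUnitaryGroup (Fin N) ℂ | ∑ i, ∑ j, ‖((V : Matrix (Fin N) (Fin N) ℂ) - 1) i j‖ ^ 2 ≤ η ^ 2} := by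
  ext V
  simp only [Set.mem_setOf_eq]
  rw [← Literature.MathematicalPhysics.QuantumFieldTheory.UnitaryCayley.frobenius_norm_sq, pow_le_pow_iff_left₀ (norm_nonneg _) hη two_ne_zero]

/-- The dimension as a real number: `((N² − 1 : ℕ) : ℝ) = N² − 1` for `N ≥ 1` (for `N = 0` both `SU(0)` and the exponent are trivial). [folklore] -/
theorem cast_dim {N : ℕ} (hN : 1 ≤ N) : ((N ^ 2 - 1 : ℕ) : ℝ) = (N : ℝ) ^ 2 - 1 := by
  rw [Nat.cast_sub (Nat.one_le_pow _ _ hN), Nat.cast_pow, Nat.cast_one]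

/-- **TWO-SIDED SMALL-BALL LAW FOR THE HILBERT–SCHMIDT WINDOW OF `SU(N)`, EXPONENT `N² − 1 = dim SU(N)`, ALL `N`**: for every `R > 0`
there is `C ≥ 1` with `C⁻¹·η^{N²−1} ≤ Haar_{SU(N)}{‖V − 1‖_HS ≤ η} ≤ C·η^{N²−1}` for all `0 < η ≤ R` (`N = 0`: `SU(0)` is a point and the
exponent is `0`). [folklore] -/
theorem exists_haarReal_sball_two_sided {R : ℝ} (hR : 0 < R) : ∃ C : ℝ, 1 ≤ C ∧ ∀ η : ℝ, 0 < η → η ≤ R → C⁻¹ * η ^ (N ^ 2 - 1) ≤ (haarProbability (Matrix.specialUnitaryGroup (Fin N) ℂ)).real {V : Matrix.specialUnitaryGroup (Fin N) ℂ | ‖(V : Matrix (Fin N) (Fin N) ℂ) - 1‖ ≤ η} ∧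
    (haarProbability (Matrix.specialUnitaryGroup (Fin N) ℂ)).real {V : Matrix.specialUnitaryGroup (Fin N) ℂ | ‖(V : Matrix (Fin N) (Fin N) ℂ) - 1‖ ≤ η} ≤ C * η ^ (N ^ 2 - 1) := by
  rcases Nat.eq_zero_or_pos N with hN | hN
  · subst hN
    refine ⟨1, le_rfl, fun η hη _ => ?_⟩
    have huniv : {V : Matrix.specialUnitaryGroup (Fin 0) ℂ | ‖(V : Matrix (Fin 0) (Fin 0) ℂ) - 1‖ ≤ η} = Set.univ := Set.eq_univ_of_forall fun V => by
      rw [Set.mem_setOf_eq, Subsingleton.elim ((V : Matrix (Fin 0) (Fin 0) ℂ) - 1) 0, norm_zero]; exact hη.le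
    rw [huniv, probReal_univ]; norm_num
  · obtain ⟨C, hC, h⟩ := exists_haarReal_hsBall_two_sided hN hR
    refine ⟨max C 1, le_max_right _ _, fun η hη hηR => ?_⟩
    obtain ⟨hlow, hup⟩ := h η hη hηR
    rw [sball_eq_hsBall hη.le]
    refine ⟨le_trans ?_ hlow, hup.trans ?_⟩
    · exact mul_le_mul_of_nonneg_right (inv_anti₀ hC (le_max_left _ _)) (by positivity)
    · exact mul_le_mul_of_nonneg_right (le_max_left _ _) (by positivity)

/-- **SMALL HILBERT–SCHMIDT BALLS OF `SU(N)` HAVE HAAR MEASURE `≥ C·η^{N²−1}`** (`0 < η ≤ 2`, some `C > 0`) — `CompactFibreWindowSUN.exists_haar_sball_ge`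
with the exponent `N²` of `dim U(N)` replaced by `N² − 1 = dim SU(N)`. [folklore] -/
theorem exists_haar_sball_ge_sharp : ∃ C : ℝ, 0 < C ∧ ∀ η : ℝ, 0 < η → η ≤ 2 → ENNReal.ofReal (C * η ^ (N ^ 2 - 1)) ≤ haarProbability (Matrix.specialUnitaryGroup (Fin N) ℂ) {V : Matrix.specialUnitaryGroup (Fin N) ℂ | ‖(V : Matrix (Fin N) (Fin N) ℂ) - 1‖ ≤ η} := by
  obtain ⟨C, hC, h⟩ := exists_haarReal_sball_two_sided (N := N) two_pos
  refine ⟨C⁻¹, by positivity, fun η hη hη2 => (ENNReal.ofReal_le_iff_le_toReal (measure_ne_top _ _)).2 ?_⟩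
  simpa only [measureReal_def] using (h η hη hη2).1

/-- **… AND `≤ C·η^{N²−1}`** (`0 < η ≤ 2`). [folklore] -/
theorem exists_haar_sball_le_sharp : ∃ C : ℝ, 0 < C ∧ ∀ η : ℝ, 0 < η → η ≤ 2 → haarProbability (Matrix.specialUnitaryGroup (Fin N) ℂ) {V : Matrix.specialUnitaryGroup (Fin N) ℂ | ‖(V : Matrix (Fin N) (Fin N) ℂ) - 1‖ ≤ η} ≤ ENNReal.ofReal (C * η ^ (N ^ 2 - 1)) := by
  obtain ⟨C, hC, h⟩ := exists_haarReal_sball_two_sided (N := N) two_pos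
  refine ⟨C, by positivity, fun η hη hη2 => (ENNReal.le_ofReal_iff_toReal_le (measure_ne_top _ _) (by positivity)).2 ?_⟩
  simpa only [measureReal_def] using (h η hη hη2).2

/-- From a two-sided power law to a two-sided LOG PIN: `C⁻¹η^d ≤ m ≤ Cη^d`, `C ≥ 1`, `η > 0` give `0 < m` and `|−log m − d·log η⁻¹| ≤ log C`. [folklore] -/
theorem abs_neg_log_sub_le_of_two_sided {C η m : ℝ} {d : ℕ} (hC : 1 ≤ C) (hη : 0 < η) (hlow : C⁻¹ * η ^ d ≤ m) (hup : m ≤ C * η ^ d) : 0 < m ∧ |-Real.log m - (d : ℝ) * Real.log η⁻¹| ≤ Real.log C := by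
  have hCpos : 0 < C := by linarith
  have hpow : 0 < η ^ d := pow_pos hη d
  have hm : 0 < m := lt_of_lt_of_le (by positivity) hlow
  have h1 := Real.log_le_log (by positivity) hlow
  have h2 := Real.log_le_log hm hup
  rw [Real.log_mul (by positivity) hpow.ne', Real.log_inv, Real.log_pow] at h1
  rw [Real.log_mul hCpos.ne' hpow.ne', Real.log_pow] at h2
  exact ⟨hm, by rw [Real.log_inv, abs_le]; constructor <;> linarith⟩

/-- **THE LOG PIN OF THE WINDOW-VOLUME LETTER, `SU(N)`, HILBERT–SCHMIDT WINDOW**: there is `c ≥ 0` with, for all `0 < η ≤ 2`,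
`Haar(SB η) > 0` and `|−log Haar_{SU(N)}{‖V − 1‖_HS ≤ η} − (N² − 1)·log η⁻¹| ≤ c` — the letter is `dim SU(N)·log η⁻¹ + O(1)`. [folklore] -/
theorem exists_abs_neg_log_haar_sball_sub_le : ∃ c : ℝ, 0 ≤ c ∧ ∀ η : ℝ, 0 < η → η ≤ 2 → 0 < (haarProbability (Matrix.specialUnitaryGroup (Fin N) ℂ)).real {V : Matrix.specialUnitaryGroup (Fin N) ℂ | ‖(V : Matrix (Fin N) (Fin N) ℂ) - 1‖ ≤ η} ∧ |-Real.log ((haarProbability (Matrix.specialUnitaryGroup (Fin N) ℂ)).real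
    {V : Matrix.specialUnitaryGroup (Fin N) ℂ | ‖(V : Matrix (Fin N) (Fin N) ℂ) - 1‖ ≤ η}) - ((N ^ 2 - 1 : ℕ) : ℝ) * Real.log η⁻¹| ≤ c := by
  obtain ⟨C, hC, h⟩ := exists_haarReal_sball_two_sided (N := N) two_pos
  refine ⟨Real.log C, Real.log_nonneg hC, fun η hη hη2 => ?_⟩
  obtain ⟨hlow, hup⟩ := h η hη hη2
  exact abs_neg_log_sub_le_of_two_sided hC hη hlow hup

/-- **THE PRICE (upper half alone), `SU(N)`, HILBERT–SCHMIDT WINDOW**: `−log Haar_{SU(N)}{‖V − 1‖_HS ≤ η} ≤ (N² − 1)·log η⁻¹ + c` for `0 < η ≤ 2` —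
`CompactFibreWindowSUN.exists_neg_log_haar_sball_le`'s `N²·log(2∕η) − log C` at print's rate. [folklore] -/
theorem exists_neg_log_haar_sball_le_sharp : ∃ c : ℝ, 0 ≤ c ∧ ∀ η : ℝ, 0 < η → η ≤ 2 → 0 < (haarProbability (Matrix.specialUnitaryGroup (Fin N) ℂ)).real {V : Matrix.specialUnitaryGroup (Fin N) ℂ | ‖(V : Matrix (Fin N) (Fin N) ℂ) - 1‖ ≤ η} ∧ -Real.log ((haarProbability (Matrix.specialUnitaryGroup (Fin N) ℂ)).real
    {V : Matrix.specialUnitaryGroup (Fin N) ℂ | ‖(V : Matrix (Fin N) (Fin N) ℂ) - 1‖ ≤ η}) ≤ ((N ^ 2 - 1 : ℕ) : ℝ) * Real.log η⁻¹ + c := by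
  obtain ⟨c, hc, h⟩ := exists_abs_neg_log_haar_sball_sub_le (N := N)
  refine ⟨c, hc, fun η hη hη2 => ?_⟩
  obtain ⟨hpos, habs⟩ := h η hη hη2
  exact ⟨hpos, by linarith [(abs_le.1 habs).2]⟩

/-- A squeeze in `log η⁻¹`: if `|f(η) − d·log η⁻¹| ≤ c` for `0 < η ≤ a` then `f(η)∕log η⁻¹ → d` as `η → 0⁺`. [folklore] -/
theorem tendsto_div_log_inv_of_abs_sub_le {f : ℝ → ℝ} {d c a : ℝ} (ha : 0 < a) (h : ∀ η : ℝ, 0 < η → η ≤ a → |f η - d * Real.log η⁻¹| ≤ c) : Tendsto (fun η : ℝ => f η / Real.log η⁻¹) (𝓝[>] 0) (𝓝 d) := by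
  have hL : Tendsto (fun η : ℝ => Real.log η⁻¹) (𝓝[>] 0) atTop := by
    simp_rw [Real.log_inv]; exact tendsto_neg_atBot_atTop.comp Real.tendsto_log_nhdsGT_zero
  have hup : Tendsto (fun η : ℝ => d + c / Real.log η⁻¹) (𝓝[>] 0) (𝓝 d) := by
    simpa using tendsto_const_nhds.add (tendsto_const_nhds.div_atTop hL)
  have hlow : Tendsto (fun η : ℝ => d - c / Real.log η⁻¹) (𝓝[>] 0) (𝓝 d) := by
    simpa using tendsto_const_nhds.sub (tendsto_const_nhds.div_atTop hL)
  have hev : ∀ᶠ η in 𝓝[>] (0 : ℝ), 0 < η ∧ η ≤ a ∧ 1 < Real.log η⁻¹ := by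
    have h1 : ∀ᶠ η in 𝓝[>] (0 : ℝ), 0 < η := self_mem_nhdsWithin
    have h2 : ∀ᶠ η in 𝓝[>] (0 : ℝ), η ≤ a := (eventually_le_nhds ha).filter_mono nhdsWithin_le_nhds
    have h3 : ∀ᶠ η in 𝓝[>] (0 : ℝ), 1 < Real.log η⁻¹ := hL.eventually_gt_atTop 1
    exact (h1.and (h2.and h3))
  refine tendsto_of_tendsto_of_tendsto_of_le_of_le' hlow hup ?_ ?_
  · filter_upwards [hev] with η hη
    obtain ⟨h0, hηa, hL1⟩ := hη
    have hLpos : 0 < Real.log η⁻¹ := by linarith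
    have hb := (abs_le.1 (h η h0 hηa)).1
    rw [le_div_iff₀ hLpos]
    have he : (d - c / Real.log η⁻¹) * Real.log η⁻¹ = d * Real.log η⁻¹ - c := by
      rw [sub_mul, div_mul_cancel₀ _ hLpos.ne']
    rw [he]; linarith
  · filter_upwards [hev] with η hη
    obtain ⟨h0, hηa, hL1⟩ := hη
    have hLpos : 0 < Real.log η⁻¹ := by linarith
    have hb := (abs_le.1 (h η h0 hηa)).2
    rw [div_le_iff₀ hLpos]
    have he : (d + c / Real.log η⁻¹) * Real.log η⁻¹ = d * Real.log η⁻¹ + c := by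
      rw [add_mul, div_mul_cancel₀ _ hLpos.ne']
    rw [he]; linarith

/-- **THE RATE: `−log Haar_{SU(N)}{‖V − 1‖_HS ≤ η} ∕ log η⁻¹ → N² − 1 = dim SU(N)`** as `η → 0⁺` (all `N`; `CompactFibreWindowSU2Rate`'s `3∕2` is the
`N = 2` trace-window instance below, since `‖V − 1‖²_HS = 2·Re tr(1 − V)`). [folklore] -/
theorem tendsto_neg_log_haar_sball_div_log : Tendsto (fun η : ℝ => -Real.log ((haarProbability (Matrix.specialUnitaryGroup (Fin N) ℂ)).real {V : Matrix.specialUnitaryGroup (Fin N) ℂ | ‖(V : Matrix (Fin N) (Fin N) ℂ) - 1‖ ≤ η}) / Real.log η⁻¹) (𝓝[>] 0) (𝓝 ((N ^ 2 - 1 : ℕ) : ℝ)) := by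
  obtain ⟨c, _, h⟩ := exists_abs_neg_log_haar_sball_sub_le (N := N)
  exact tendsto_div_log_inv_of_abs_sub_le two_pos fun η hη hη2 => (h η hη hη2).2

/-! ### The TRACE (action) window `{Re tr(1 − V) ≤ t}` — print's rate `½·d(𝔤) = (N² − 1)∕2` -/

/-- The trace window is the Hilbert–Schmidt window of radius `√(2t)` (`t ≥ 0`; `CompactFibreWindowSUN.sball_eq_traceWindow`). [folklore] -/
theorem traceWindow_eq_sball {t : ℝ} (ht : 0 ≤ t) : {V : Matrix.specialUnitaryGroup (Fin N) ℂ | (Matrix.trace (1 - (V : Matrix (Fin N) (Fin N) ℂ))).re ≤ t} = {V : Matrix.specialUnitaryGroup (Fin N) ℂ | ‖(V : Matrix (Fin N) (Fin N) ℂ) - 1‖ ≤ Real.sqrt (2 * t)} := by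
  rw [CompactFibreWindowSUN.sball_eq_traceWindow (Real.sqrt_nonneg _), Real.sq_sqrt (by positivity)]
  ext V; simp only [Set.mem_setOf_eq]; constructor <;> intro h <;> linarith

/-- **TWO-SIDED LAW FOR THE TRACE WINDOW**: for every `R > 0` there is `C ≥ 1` with `C⁻¹·(2t)^{(N²−1)/2}`-shaped bounds, stated as
`C⁻¹·√(2t)^{N²−1} ≤ Haar_{SU(N)}{Re tr(1 − V) ≤ t} ≤ C·√(2t)^{N²−1}` for `0 < t`, `√(2t) ≤ R`. [folklore] -/
theorem exists_haarReal_traceWindow_two_sided {R : ℝ} (hR : 0 < R) : ∃ C : ℝ, 1 ≤ C ∧ ∀ t : ℝ, 0 < t → Real.sqrt (2 * t) ≤ R → C⁻¹ * Real.sqrt (2 * t) ^ (N ^ 2 - 1) ≤ (haarProbability (Matrix.specialUnitaryGroup (Fin N) ℂ)).real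
    {V : Matrix.specialUnitaryGroup (Fin N) ℂ | (Matrix.trace (1 - (V : Matrix (Fin N) (Fin N) ℂ))).re ≤ t} ∧ (haarProbability (Matrix.specialUnitaryGroup (Fin N) ℂ)).real {V : Matrix.specialUnitaryGroup (Fin N) ℂ | (Matrix.trace (1 - (V : Matrix (Fin N) (Fin N) ℂ))).re ≤ t} ≤ C * Real.sqrt (2 * t) ^ (N ^ 2 - 1) := by
  obtain ⟨C, hC, h⟩ := exists_haarReal_sball_two_sided (N := N) hR
  refine ⟨C, hC, fun t ht htR => ?_⟩
  rw [traceWindow_eq_sball ht.le]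
  exact h _ (Real.sqrt_pos.2 (by positivity)) htR

/-- **THE LOG PIN OF THE TRACE-WINDOW LETTER AT PRINT's RATE `½·d(𝔤)`**: there is `c ≥ 0` with, for all `0 < t ≤ 2`, `Haar > 0` and
`|−log Haar_{SU(N)}{Re tr(1 − V) ≤ t} − ((N² − 1)∕2)·log t⁻¹| ≤ c`. [folklore] -/
theorem exists_abs_neg_log_haar_traceWindow_sub_le : ∃ c : ℝ, 0 ≤ c ∧ ∀ t : ℝ, 0 < t → t ≤ 2 → 0 < (haarProbability (Matrix.specialUnitaryGroup (Fin N) ℂ)).real {V : Matrix.specialUnitaryGroup (Fin N) ℂ | (Matrix.trace (1 - (V : Matrix (Fin N) (Fin N) ℂ))).re ≤ t} ∧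
    |-Real.log ((haarProbability (Matrix.specialUnitaryGroup (Fin N) ℂ)).real {V : Matrix.specialUnitaryGroup (Fin N) ℂ | (Matrix.trace (1 - (V : Matrix (Fin N) (Fin N) ℂ))).re ≤ t}) - ((N ^ 2 - 1 : ℕ) : ℝ) / 2 * Real.log t⁻¹| ≤ c := by
  obtain ⟨C, hC, h⟩ := exists_haarReal_traceWindow_two_sided (N := N) two_pos
  set d : ℕ := N ^ 2 - 1 with hd
  refine ⟨Real.log C + (d : ℝ) / 2 * Real.log 2,
    add_nonneg (Real.log_nonneg hC) (mul_nonneg (by positivity) (Real.log_nonneg one_le_two)), fun t ht ht2 => ?_⟩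
  have hs : Real.sqrt (2 * t) ≤ 2 :=
    calc Real.sqrt (2 * t) ≤ Real.sqrt (2 * 2) := Real.sqrt_le_sqrt (by linarith)
      _ = 2 := Real.sqrt_mul_self zero_le_two
  obtain ⟨hlow, hup⟩ := h t ht hs
  obtain ⟨hm, habs⟩ := abs_neg_log_sub_le_of_two_sided hC (Real.sqrt_pos.2 (by positivity)) hlow hup
  refine ⟨hm, ?_⟩
  -- `log (√(2t))⁻¹ = ½ (log t⁻¹ − log 2)`
  have hlog : Real.log (Real.sqrt (2 * t))⁻¹ = (Real.log t⁻¹ - Real.log 2) / 2 := by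
    rw [Real.log_inv, Real.log_sqrt (by positivity), Real.log_mul two_ne_zero ht.ne', Real.log_inv]; ring
  rw [hlog] at habs
  have hd0 : (0 : ℝ) ≤ d := Nat.cast_nonneg d
  have hl2 : 0 ≤ Real.log 2 := Real.log_nonneg one_le_two
  rw [abs_le] at habs ⊢
  constructor <;> nlinarith [habs.1, habs.2]

/-- **THE RATE AT PRINT's EXPONENT: `−log Haar_{SU(N)}{Re tr(1 − V) ≤ t} ∕ log t⁻¹ → (N² − 1)∕2 = ½·dim SU(N)`** as `t → 0⁺` — for `N = 2` this is
`CompactFibreWindowSU2Rate.tendsto_neg_log_haar_traceWindow_div_log`'s `3∕2` (there with explicit constants from the quaternion chart). [folklore] -/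
theorem tendsto_neg_log_haar_traceWindow_div_log : Tendsto (fun t : ℝ => -Real.log ((haarProbability (Matrix.specialUnitaryGroup (Fin N) ℂ)).real {V : Matrix.specialUnitaryGroup (Fin N) ℂ | (Matrix.trace (1 - (V : Matrix (Fin N) (Fin N) ℂ))).re ≤ t}) / Real.log t⁻¹) (𝓝[>] 0) (𝓝 (((N ^ 2 - 1 : ℕ) : ℝ) / 2)) := by
  obtain ⟨c, _, h⟩ := exists_abs_neg_log_haar_traceWindow_sub_le (N := N)
  exact tendsto_div_log_inv_of_abs_sub_le two_pos fun t ht ht2 => (h t ht ht2).2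

/-- **PRINT's SHAPE** («`log z ≥ d(𝐠)·log g_j − C_z`», the item `ZLower` of the tree's `B16B10Shape`): at a window of radius `η = C₀·g` (`C₀, g > 0`, `C₀g ≤ 2`),
`−log Haar_{SU(N)}{‖V − 1‖_HS ≤ C₀g} ≤ (N² − 1)·log g⁻¹ + (c − (N² − 1)·log C₀)` — rate `d(𝔤) = N² − 1` in `log g⁻¹` (`= ½d(𝔤)` in `log g⁻²`). [folklore] -/
theorem exists_neg_log_haar_sball_le_print_shape : ∃ c : ℝ, 0 ≤ c ∧ ∀ C₀ g : ℝ, 0 < C₀ → 0 < g → C₀ * g ≤ 2 → -Real.log ((haarProbability (Matrix.specialUnitaryGroup (Fin N) ℂ)).real {V : Matrix.specialUnitaryGroup (Fin N) ℂ | ‖(V : Matrix (Fin N) (Fin N) ℂ) - 1‖ ≤ C₀ * g}) ≤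
    ((N ^ 2 - 1 : ℕ) : ℝ) * Real.log g⁻¹ + (c - ((N ^ 2 - 1 : ℕ) : ℝ) * Real.log C₀) := by
  obtain ⟨c, hc, h⟩ := exists_neg_log_haar_sball_le_sharp (N := N)
  refine ⟨c, hc, fun C₀ g hC₀ hg hle => ?_⟩
  have h1 := (h (C₀ * g) (by positivity) hle).2
  have hlog : Real.log (C₀ * g)⁻¹ = Real.log g⁻¹ - Real.log C₀ := by
    rw [Real.log_inv, Real.log_inv, Real.log_mul hC₀.ne' hg.ne']; ring
  rw [hlog] at h1
  linarith

end HS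

/-! ## §3 A region: the product Haar window over its bonds, ALL `N` — the per-bond letter at rate `N² − 1` and the junction with the OWNER's display -/

section Region

open scoped Matrix.Norms.Frobenius

variable {B : Type*} [Fintype B]

/-- **THE PER-DEGREE-OF-FREEDOM LETTER PINNED ON BOTH SIDES, ALL `N`**: there is `c ≥ 0` with, for all `0 < η ≤ 2`, the product window has positive mass and
`|−log κ(Π_b SB η) − #bonds·(N² − 1)·log η⁻¹| ≤ #bonds·c` (`κ` = product Haar probability on `bonds → SU(N)`, `SB η` the Hilbert–Schmidt window). [folklore] -/
theorem exists_abs_neg_log_pi_sball_sub_le : ∃ c : ℝ, 0 ≤ c ∧ ∀ η : ℝ, 0 < η → η ≤ 2 → 0 < ((Measure.pi fun _ : B => haarProbability (Matrix.specialUnitaryGroup (Fin N) ℂ)) (Set.univ.pi fun _ : B => {V : Matrix.specialUnitaryGroup (Fin N) ℂ | ‖(V : Matrix (Fin N) (Fin N) ℂ) - 1‖ ≤ η})).toReal ∧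
    |-Real.log ((Measure.pi fun _ : B => haarProbability (Matrix.specialUnitaryGroup (Fin N) ℂ)) (Set.univ.pi fun _ : B => {V : Matrix.specialUnitaryGroup (Fin N) ℂ | ‖(V : Matrix (Fin N) (Fin N) ℂ) - 1‖ ≤ η})).toReal - (Fintype.card B : ℝ) * (((N ^ 2 - 1 : ℕ) : ℝ) * Real.log η⁻¹)| ≤ (Fintype.card B : ℝ) * c := by
  obtain ⟨c, hc, h⟩ := exists_abs_neg_log_haar_sball_sub_le (N := N)
  refine ⟨c, hc, fun η hη hη2 => ?_⟩
  obtain ⟨hpos, habs⟩ := h η hη hη2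
  rw [measureReal_def] at hpos habs
  refine ⟨?_, ?_⟩
  · rw [CompactFibreWindowSUN.pi_sball_toReal_eq]; exact pow_pos hpos _
  · rw [CompactFibreWindowSUN.pi_sball_toReal_eq, Real.log_pow, show ∀ x y : ℝ, -((Fintype.card B : ℝ) * x) - (Fintype.card B : ℝ) * y = (Fintype.card B : ℝ) * (-x - y) from fun x y => by ring,
      abs_mul, Nat.abs_cast]
    exact mul_le_mul_of_nonneg_left habs (Nat.cast_nonneg _)

/-- **THE PER-DEGREE-OF-FREEDOM PRICE BY VALUE AT PRINT's RATE, ALL `N`**: there is `c ≥ 0` with, for all `0 < η ≤ 2`, positive mass and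
`−log κ(Π_b SB η) ≤ #bonds·((N² − 1)·log η⁻¹ + c)` — `CompactFibreWindowSUN.exists_neg_log_pi_sball_le`'s `#bonds·(N²·log(2∕η) − log C)` with the exponent
of `dim SU(N)`. [folklore] -/
theorem exists_neg_log_pi_sball_le_sharp : ∃ c : ℝ, 0 ≤ c ∧ ∀ η : ℝ, 0 < η → η ≤ 2 → 0 < ((Measure.pi fun _ : B => haarProbability (Matrix.specialUnitaryGroup (Fin N) ℂ)) (Set.univ.pi fun _ : B => {V : Matrix.specialUnitaryGroup (Fin N) ℂ | ‖(V : Matrix (Fin N) (Fin N) ℂ) - 1‖ ≤ η})).toReal ∧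
    -Real.log ((Measure.pi fun _ : B => haarProbability (Matrix.specialUnitaryGroup (Fin N) ℂ)) (Set.univ.pi fun _ : B => {V : Matrix.specialUnitaryGroup (Fin N) ℂ | ‖(V : Matrix (Fin N) (Fin N) ℂ) - 1‖ ≤ η})).toReal ≤ (Fintype.card B : ℝ) * (((N ^ 2 - 1 : ℕ) : ℝ) * Real.log η⁻¹ + c) := by
  obtain ⟨c, hc, h⟩ := exists_abs_neg_log_pi_sball_sub_le (N := N) (B := B)
  refine ⟨c, hc, fun η hη hη2 => ?_⟩
  obtain ⟨hpos, habs⟩ := h η hη hη2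
  refine ⟨hpos, ?_⟩
  have := (abs_le.1 habs).2
  linarith

/-- **THE JUNCTION FOR THE `SU(N)` PRODUCT FIBRE AT PRINT's RATE, ALL `N`** (`CompactFibreWindowSUN.exists_compactFibre_moment_le_SUNwindow` with the sharp letter):
there is `c ≥ 0` such that for every window size `0 < η ≤ 2`, on the near fibre `bonds → SU(N)` with the product Haar probability and the product
Hilbert–Schmidt window, a numerator factor `0 ≤ F ≤ 1` carried by POSITIVITY and an interaction `≤ i⁺` on the window give
`∫ F·w·e^{−I} d(κ⊗μ) ≤ exp(i⁺ + #bonds·((N² − 1)·log η⁻¹ + c)) · ∫ 𝟙_W·w·e^{−I} d(κ⊗μ)`. [folklore] -/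
theorem exists_compactFibre_moment_le_SUNwindow_sharp {Y : Type*} [MeasurableSpace Y] (μ : Measure Y) [SFinite μ] : ∃ c : ℝ, 0 ≤ c ∧ ∀ η : ℝ, 0 < η → η ≤ 2 → ∀ (F : (B → (Matrix.specialUnitaryGroup (Fin N) ℂ)) → ℝ) (w : Y → ℝ) (I : (B → (Matrix.specialUnitaryGroup (Fin N) ℂ)) × Y → ℝ) (ip : ℝ),
    (∀ x, 0 ≤ F x) → (∀ x, F x ≤ 1) → Integrable F (Measure.pi fun _ : B => haarProbability (Matrix.specialUnitaryGroup (Fin N) ℂ)) → (∀ y, 0 ≤ w y) → (∀ z : (B → (Matrix.specialUnitaryGroup (Fin N) ℂ)) × Y, F z.1 ≠ 0 → w z.2 ≠ 0 → 0 ≤ I z) →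
    (∀ z : (B → (Matrix.specialUnitaryGroup (Fin N) ℂ)) × Y, z.1 ∈ (Set.univ.pi fun _ : B => {V : Matrix.specialUnitaryGroup (Fin N) ℂ | ‖(V : Matrix (Fin N) (Fin N) ℂ) - 1‖ ≤ η}) → w z.2 ≠ 0 → I z ≤ ip) →
    Integrable (fun z : (B → (Matrix.specialUnitaryGroup (Fin N) ℂ)) × Y => F z.1 * w z.2) ((Measure.pi fun _ : B => haarProbability (Matrix.specialUnitaryGroup (Fin N) ℂ)).prod μ) →
    Integrable (fun z : (B → (Matrix.specialUnitaryGroup (Fin N) ℂ)) × Y => (Set.univ.pi fun _ : B => {V : Matrix.specialUnitaryGroup (Fin N) ℂ | ‖(V : Matrix (Fin N) (Fin N) ℂ) - 1‖ ≤ η}).indicator 1 z.1 * w z.2 * exp (-I z)) ((Measure.pi fun _ : B => haarProbability (Matrix.specialUnitaryGroup (Fin N) ℂ)).prod μ) →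
    ∫ z, F z.1 * w z.2 * exp (-I z) ∂((Measure.pi fun _ : B => haarProbability (Matrix.specialUnitaryGroup (Fin N) ℂ)).prod μ) ≤ exp (ip + (Fintype.card B : ℝ) * (((N ^ 2 - 1 : ℕ) : ℝ) * Real.log η⁻¹ + c)) *
    ∫ z, (Set.univ.pi fun _ : B => {V : Matrix.specialUnitaryGroup (Fin N) ℂ | ‖(V : Matrix (Fin N) (Fin N) ℂ) - 1‖ ≤ η}).indicator 1 z.1 * w z.2 * exp (-I z) ∂((Measure.pi fun _ : B => haarProbability (Matrix.specialUnitaryGroup (Fin N) ℂ)).prod μ) := by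
  obtain ⟨c, hc, h⟩ := exists_neg_log_pi_sball_le_sharp (N := N) (B := B)
  refine ⟨c, hc, fun η hη hη2 F w I ip hF0 hF1 hFi hw0 hIpos hIsmall hA hB' => ?_⟩
  obtain ⟨hpos, hlog⟩ := h η hη hη2
  exact CompactFibreWindowSU2.compactFibre_moment_le_window_exp (Measure.pi fun _ : B => haarProbability (Matrix.specialUnitaryGroup (Fin N) ℂ)) μ _
    (MeasurableSet.univ_pi fun _ => CompactFibreWindowSUN.measurableSet_sball η) F w I hF0 hF1 hFi hw0 hIpos hIsmall hpos hlog hA hB'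

/-- **THE TRACE-WINDOW LETTER OF A REGION PINNED ON BOTH SIDES AT PRINT's RATE `½·d(𝔤)`**: there is `c ≥ 0` with, for all `0 < t ≤ 2`, positive mass and
`|−log κ(Π_b {Re tr(1 − V_b) ≤ t}) − #bonds·((N² − 1)∕2)·log t⁻¹| ≤ #bonds·c` — `CompactFibreWindowSU2Rate.abs_neg_log_pi_traceWindow_sub_le`'s
`#B·(3∕2)·log η⁻¹ ± #B·log 160` for every `N` (soft constant). [folklore] -/
theorem exists_abs_neg_log_pi_traceWindow_sub_le : ∃ c : ℝ, 0 ≤ c ∧ ∀ t : ℝ, 0 < t → t ≤ 2 → 0 < ((Measure.pi fun _ : B => haarProbability (Matrix.specialUnitaryGroup (Fin N) ℂ)) (Set.univ.pi fun _ : B => {V : Matrix.specialUnitaryGroup (Fin N) ℂ | (Matrix.trace (1 - (V : Matrix (Fin N) (Fin N) ℂ))).re ≤ t})).toReal ∧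
    |-Real.log ((Measure.pi fun _ : B => haarProbability (Matrix.specialUnitaryGroup (Fin N) ℂ)) (Set.univ.pi fun _ : B => {V : Matrix.specialUnitaryGroup (Fin N) ℂ | (Matrix.trace (1 - (V : Matrix (Fin N) (Fin N) ℂ))).re ≤ t})).toReal -
    (Fintype.card B : ℝ) * (((N ^ 2 - 1 : ℕ) : ℝ) / 2 * Real.log t⁻¹)| ≤ (Fintype.card B : ℝ) * c := by
  obtain ⟨c, hc, h⟩ := exists_abs_neg_log_haar_traceWindow_sub_le (N := N)
  refine ⟨c, hc, fun t ht ht2 => ?_⟩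
  obtain ⟨hpos, habs⟩ := h t ht ht2
  rw [measureReal_def] at hpos habs
  refine ⟨?_, ?_⟩
  · rw [CompactFibreCarrier.pi_window_measure, Finset.prod_const, Finset.card_univ]; exact pow_pos hpos _
  · rw [CompactFibreCarrier.pi_window_measure, Finset.prod_const, Finset.card_univ, Real.log_pow, show ∀ x y : ℝ, -((Fintype.card B : ℝ) * x) - (Fintype.card B : ℝ) * y = (Fintype.card B : ℝ) * (-x - y) from fun x y => by ring,
      abs_mul, Nat.abs_cast]
    exact mul_le_mul_of_nonneg_left habs (Nat.cast_nonneg _)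

end Region

/-! ## §4 Sanity (non-vacuity of the hypotheses' ranges; the `N = 2` exponent) -/

section Sanity

/-- For `N = 2` the exponent is `3 = dim SU(2)` and print's rate is `3∕2` (`CompactFibreWindowSU2Rate`); for `N = 3` it is `8 = dim SU(3)`, rate `4`. [folklore] -/
example : ((2 ^ 2 - 1 : ℕ) : ℝ) / 2 = 3 / 2 ∧ ((3 ^ 2 - 1 : ℕ) : ℝ) / 2 = 4 := by norm_num

end Sanity

end

end Summit.QuantumFields.BalabanUV.T4Continuum.NE7b.CompactFibreWindowSUNRate
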